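import Mathlib
import Summits.NavierStokesRegularity.NavierStokesRegularity.Theses.ExactWindowRungThree
import Summits.NavierStokesRegularity.NavierStokesRegularity.Theorems.ExactWindowRungThreeSegmentMeanValue
import HarnessLib

/-!
# `ExactWindowRungThree.EnclosureSplitGlueR` — glue of the gen-1 split of `ExactFlowCertificateR`
  (item stmt-NavierStokesRegularity-23956; pure logic)

**Statement.** `DerivativeEnclosureCertificateR → EnclosureGlueR → ExactFlowCertificateR`.

PROOF. `EnclosureGlueR` is `DerivativeEnclosureCertificateR → SegmentMeanValue → ExactFlowCertificateR`
and `SegmentMeanValue` is the tree theorem `exactWindowRungThree_segmentMeanValue_proof`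
(item stmt-NavierStokesRegularity-23174, closed); modus ponens.

HONEST FRAMING: bookkeeping between certificate FORMATS for ONE Tao-type MODEL lattice table; no
certificate is produced here and nothing is said about the Navier–Stokes equations.
-/

noncomputable section

set_option linter.dupNamespace false

namespace Summit.NavierStokesRegularity.NavierStokesRegularity.Theorems

/-- **Item stmt-NavierStokesRegularity-23956** (`ExactWindowRungThree.EnclosureSplitGlueR`): the
repaired-reach derivative-enclosure certificate and the glue `EnclosureGlueR` give the repaired
exact-flow certificate, the segment mean value inequality being a tree theorem. [this file] -/
theorem exactWindowRungThree_enclosureSplitGlueR_proof :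
    Summit.NavierStokesRegularity.NavierStokesRegularity.Theses.ExactWindowRungThree.EnclosureSplitGlueR := by
  unfold Summit.NavierStokesRegularity.NavierStokesRegularity.Theses.ExactWindowRungThree.EnclosureSplitGlueR
    Summit.NavierStokesRegularity.NavierStokesRegularity.Theses.ExactWindowRungThree.EnclosureGlueR
  intro hD hG
  exact hG hD exactWindowRungThree_segmentMeanValue_proof

end Summit.NavierStokesRegularity.NavierStokesRegularity.Theorems

end
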